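import Literature.Probability.RandomPlanarGeometry.RestrictionSubadditivity
import Literature.Analysis.Complex.ArcGreenConeLower
import HarnessLib

/-!
# A uniform defect for `Φ'_A(0)` from an arc crossing a cone-annulus

The single-scale estimate behind [LSW] Lemma 6.3 (`Φ'_{A_t}(W_t) → 0` when the SLE hull hits a
smooth hull `A`): if a `*`-hull `Q` contains a Jordan arc `L` which crosses the cone-annulus
`{r₁ ≤ ‖z‖ ≤ r₂} ∩ {|re z| ≤ c im z}` from the outer circle to the inner one, then

  `Φ'_Q(0) ≤ 1 - κ`,  `κ = κ(c, r₁, r₂) > 0`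

(`exists_restrictionDeriv_le_of_arc`). In [LSW] this is the statement that a Brownian excursion
from `0` hits such a set with probability bounded below (proof of Lemma 6.3, p. 940: "with
probability bounded away from `0`, the excursion hits `A_t`"), via `Φ'_Q(0) = P[excursion avoids
Q]`. Here it is proved potential-theoretically: with the Green function `g` of `ℂ ∖ L`
(`ArcInversion` … `ArcGreenConeLower`) and `q(w) = g(w̄) - g(w)`,

* `u(w) = im w - im Φ_Q(w) ≥ q(w)/K` on `ℍ ∖ Q` — maximum principle for the harmonic function
  `q/K - u` on `ℍ ∖ Q` (`harmonic_le_of_frontier_of_cocompact`): at points of `∂Q ∩ ℍ`,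
  `im Φ_Q → 0` (`ConformalEquiv.tendsto_im_nhdsWithin_frontier`) and `q ≤ K im`
  (`arcGreen_conj_sub_le_mul_im`); at real boundary points both `q` and `im Φ_Q` tend to `0`;
  at `∞`, `q → 0` and `u ≥ 0` (`IsRestrictionMap.im_le_im`);
* `q(iy) ≥ κ₀ y` for small `y` (`exists_arcGreen_conj_sub_mul_I_ge`), so
  `1 - re (Φ_Q(iy)/(iy)) = u(iy)/y ≥ κ₀/K`, and `Φ_Q(iy)/(iy) → Φ'_Q(0)`.
-/

noncomputable section

open Set Filter Metric Topology Function Complex Bornology InnerProductSpace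
open Literature.Analysis.Complex
open UpperHalfPlane (upperHalfPlaneSet isOpen_upperHalfPlaneSet)
open scoped unitInterval ComplexConjugate

namespace Literature.Probability.RandomPlanarGeometry

/-- **Comparison `im w - im Φ_Q(w) ≥ q(w)/K` on `ℍ ∖ Q`** for a `*`-hull `Q ⊇ L`, `L` a Jordan
arc in the cone-annulus, `q = g ∘ conj - g` the reflected Green function of `ℂ ∖ L` and `K` the
constant of `arcGreen_conj_sub_le_mul_im`; `Φ` a restriction map of `Q` with `Φ⁻¹ → ∞` at `∞`.
Maximum principle for the harmonic `q/K - im + im Φ` on `ℍ ∖ Q`. [folklore] -/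
theorem im_sub_im_ge_arcGreen_conj_sub {c r₁ r₂ : ℝ} (hc : 0 < c) (hr₁ : 0 < r₁) (hr₁₂ : r₁ < r₂)
    {Q : Set ℂ} (hQ : IsStarHull Q) {L : Set ℂ} (e : I ≃ₜ L) (hLQ : L ⊆ Q)
    (hL : ∀ z ∈ L, r₁ ≤ ‖z‖ ∧ ‖z‖ ≤ r₂ ∧ |z.re| ≤ c * z.im)
    (ha : ‖((e 0 : L) : ℂ)‖ = r₂) (hb : ‖((e 1 : L) : ℂ)‖ = r₁)
    {Φ : ConformalEquiv (upperHalfPlaneSet \ Q) upperHalfPlaneSet} (hΦ : IsRestrictionMap Q Φ)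
    (hinf : Tendsto Φ.symm (cocompact ℂ ⊓ 𝓟 upperHalfPlaneSet) (cocompact ℂ))
    {z : ℂ} (hz : z ∈ upperHalfPlaneSet \ Q) :
    (max (Real.log 2) (Real.log (32 * r₂ / (r₂ - r₁))) * Real.sqrt (1 + c ^ 2) / r₁)⁻¹ *
        (arcGreen e (conj z) - arcGreen e z) ≤ z.im - (Φ z).im := by
  set K : ℝ := max (Real.log 2) (Real.log (32 * r₂ / (r₂ - r₁))) * Real.sqrt (1 + c ^ 2) / r₁ with hK
  have hK₀pos : 0 < max (Real.log 2) (Real.log (32 * r₂ / (r₂ - r₁))) :=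
    lt_of_lt_of_le (Real.log_pos (by norm_num)) (le_max_left _ _)
  have hKpos : 0 < K := by rw [hK]; positivity
  have hqK : ∀ w : ℂ, 0 ≤ w.im → arcGreen e (conj w) - arcGreen e w ≤ K * w.im := fun w hw ↦
    arcGreen_conj_sub_le_mul_im e hc hr₁ hr₁₂ hL ha hb hw
  have hLH : ∀ z ∈ L, 0 < z.im := fun z hz ↦ im_pos_of_mem_cone hc hr₁ hL hz
  have hQcl : IsClosed Q := hQ.isBoundedHull.isClosed
  have hUo : IsOpen (upperHalfPlaneSet \ Q) := isOpen_upperHalfPlaneSet.sdiff hQcl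
  have hUc : IsPreconnected (upperHalfPlaneSet \ Q) := hQ.isBoundedHull.isPreconnected_diff
  set f : ℂ → ℝ := fun w ↦ K⁻¹ * (arcGreen e (conj w) - arcGreen e w) - w.im + (Φ w).im with hf
  -- harmonicity
  have hharm : HarmonicOnNhd f (upperHalfPlaneSet \ Q) := by
    intro w hw
    have hwim : 0 < w.im := hw.1
    have hwL : w ∉ L := fun h ↦ hw.2 (hLQ h)
    have hcwL : conj w ∉ L := fun h ↦ by
      have := hLH _ h; rw [Complex.conj_im] at this; linarith
    have hΦa : AnalyticAt ℂ Φ w := Φ.differentiableOn.analyticAt (hUo.mem_nhds hw)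
    have h1 := (((harmonicAt_arcGreen_conj e hcwL).sub (harmonicAt_arcGreen e hwL)).const_smul
      (c := K⁻¹)).sub (harmonicAt_im w)
    exact h1.add hΦa.harmonicAt_im
  have hqc : Continuous fun w : ℂ ↦ K⁻¹ * (arcGreen e (conj w) - arcGreen e w) - w.im :=
    (continuous_const.mul (continuous_arcGreen_conj_sub e)).sub Complex.continuous_im
  -- boundary values
  have hbdry : ∀ ζ ∈ frontier (upperHalfPlaneSet \ Q), ∀ ε : ℝ, 0 < ε →
      ∀ᶠ w in 𝓝[upperHalfPlaneSet \ Q] ζ, f w ≤ 0 + ε := by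
    intro ζ hζ ε hε
    have hζim : 0 ≤ ζ.im := by
      have h1 : ζ ∈ closure {w : ℂ | 0 < w.im} := closure_mono Set.sdiff_subset (frontier_subset_closure hζ)
      rw [Complex.closure_setOf_lt_im] at h1
      exact h1
    have hle : K⁻¹ * (arcGreen e (conj ζ) - arcGreen e ζ) - ζ.im ≤ 0 := by
      have h1 := hqK ζ hζim
      have h2 : K⁻¹ * (arcGreen e (conj ζ) - arcGreen e ζ) ≤ K⁻¹ * (K * ζ.im) :=
        mul_le_mul_of_nonneg_left h1 (inv_nonneg.2 hKpos.le)
      rw [← mul_assoc, inv_mul_cancel₀ hKpos.ne', one_mul] at h2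
      linarith
    have h1 : ∀ᶠ w in 𝓝[upperHalfPlaneSet \ Q] ζ,
        K⁻¹ * (arcGreen e (conj w) - arcGreen e w) - w.im < ε / 2 := by
      have hc' := (hqc.continuousAt (x := ζ)).eventually (Iio_mem_nhds (show
        K⁻¹ * (arcGreen e (conj ζ) - arcGreen e ζ) - ζ.im < ε / 2 by linarith))
      exact hc'.filter_mono nhdsWithin_le_nhds
    have h2 : ∀ᶠ w in 𝓝[upperHalfPlaneSet \ Q] ζ, (Φ w).im < ε / 2 := by
      have := Φ.tendsto_im_nhdsWithin_frontier hQcl hinf hζ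
      exact this.eventually (Iio_mem_nhds (by linarith))
    filter_upwards [h1, h2] with w hw1 hw2
    rw [hf]; dsimp only
    linarith
  -- at infinity
  have hinf' : ∀ ε : ℝ, 0 < ε → ∀ᶠ w in cocompact ℂ ⊓ 𝓟 (upperHalfPlaneSet \ Q), f w ≤ 0 + ε := by
    intro ε hε
    have h1 := tendsto_arcGreen_conj_sub e
    rw [cobounded_eq_cocompact, Metric.tendsto_nhds] at h1
    rw [Filter.eventually_inf_principal]
    refine (h1 (K * ε) (by positivity)).mono fun w hw hwU ↦ ?_
    rw [dist_zero_right, Real.norm_eq_abs, abs_lt] at hw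
    have h2 : (Φ w).im ≤ w.im := hΦ.im_le_im hQ.isBoundedHull.1 hwU
    have h3 : K⁻¹ * (arcGreen e (conj w) - arcGreen e w) < ε := by
      rw [inv_mul_lt_iff₀ hKpos]; exact hw.2
    rw [hf]; dsimp only
    linarith
  have h := harmonic_le_of_frontier_of_cocompact hUo hUc hharm hbdry hinf' z hz
  rw [hf] at h; dsimp only at h
  linarith

/-- **[LSW] Lemma 6.3, single-scale estimate: an arc crossing a cone-annulus inside a `*`-hull
forces `Φ'_Q(0) ≤ 1 - κ`**, with `κ = κ(c, r₁, r₂) > 0` independent of the hull and of the arc.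
([LSW] phrase it as: a Brownian excursion from `0` in `ℍ` hits the hull with probability bounded
below, proof of Lemma 6.3; here: `im w - im Φ_Q(w) ≥ q(w)/K`,
`im_sub_im_ge_arcGreen_conj_sub`, and `q(iy) ≥ κ₀ y`, `exists_arcGreen_conj_sub_mul_I_ge`.)
[cite: LawlerSchrammWerner2003Restriction, proof of Lemma 6.3] -/
theorem exists_restrictionDeriv_le_of_arc {c r₁ r₂ : ℝ} (hc : 0 < c) (hr₁ : 0 < r₁) (hr₁₂ : r₁ < r₂) :
    ∃ κ : ℝ, 0 < κ ∧ ∀ {Q : Set ℂ}, IsStarHull Q → ∀ {L : Set ℂ} (e : I ≃ₜ L), L ⊆ Q →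
      (∀ z ∈ L, r₁ ≤ ‖z‖ ∧ ‖z‖ ≤ r₂ ∧ |z.re| ≤ c * z.im) → ‖((e 0 : L) : ℂ)‖ = r₂ →
      ‖((e 1 : L) : ℂ)‖ = r₁ →
      ∀ {Ψ : ConformalEquiv (upperHalfPlaneSet \ Q) upperHalfPlaneSet} {d : ℝ},
        IsRestrictionMap Q Ψ → HasRestrictionDeriv Q Ψ d → d ≤ 1 - κ := by
  set K : ℝ := max (Real.log 2) (Real.log (32 * r₂ / (r₂ - r₁))) * Real.sqrt (1 + c ^ 2) / r₁ with hK
  have hK₀pos : 0 < max (Real.log 2) (Real.log (32 * r₂ / (r₂ - r₁))) :=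
    lt_of_lt_of_le (Real.log_pos (by norm_num)) (le_max_left _ _)
  have hKpos : 0 < K := by rw [hK]; positivity
  obtain ⟨κ₀, hκ₀, hlow⟩ := exists_arcGreen_conj_sub_mul_I_ge (r₀ := r₁ / 2) hc (half_pos hr₁)
    (half_lt_self hr₁) hr₁₂
  refine ⟨K⁻¹ * κ₀, by positivity, ?_⟩
  intro Q hQ L e hLQ hL ha hb Ψ d hΨ hd
  -- WLOG the restriction map with `Φ⁻¹ → ∞`
  obtain ⟨Φ, hΦ, hinf, -⟩ := hQ.exists_isRestrictionMap_tendsto_sub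
  have heqOn : EqOn Ψ Φ (upperHalfPlaneSet \ Q) := hΦ.unique hQ hΨ
  have hdΦ : HasRestrictionDeriv Q Φ d := by
    refine (show HasRestrictionDeriv Q Ψ d from hd).congr' ?_
    filter_upwards [self_mem_nhdsWithin] with w hw
    rw [heqOn hw]
  -- small imaginary points lie in `U`
  have hQcl : IsClosed Q := hQ.isBoundedHull.isClosed
  obtain ⟨ρ, hρ, hρQ⟩ : ∃ ρ > 0, ball (0 : ℂ) ρ ⊆ Qᶜ :=
    Metric.isOpen_iff.1 hQcl.isOpen_compl 0 hQ.zero_notMem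
  have hmemU : ∀ y : ℝ, 0 < y → y < ρ → ((y : ℂ) * Complex.I) ∈ upperHalfPlaneSet \ Q :=
      fun y hy hyρ ↦ by
    refine ⟨?_, hρQ ?_⟩
    · show 0 < ((y : ℂ) * Complex.I).im
      simpa using hy
    · rw [mem_ball_zero_iff, norm_mul, Complex.norm_real, Complex.norm_I, mul_one, Real.norm_eq_abs,
        abs_of_pos hy]
      exact hyρ
  -- the comparison at `iy`
  have hcomp : ∀ y : ℝ, 0 < y → y < min ρ (r₁ / 2) →
      K⁻¹ * κ₀ ≤ 1 - (Φ ((y : ℂ) * Complex.I) / ((y : ℂ) * Complex.I)).re := by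
    intro y hy hyρ
    have hyU := hmemU y hy (lt_of_lt_of_le hyρ (min_le_left _ _))
    have h1 := im_sub_im_ge_arcGreen_conj_sub hc hr₁ hr₁₂ hQ e hLQ hL ha hb hΦ hinf hyU
    have h2 := hlow e hL ha hb y hy (lt_of_lt_of_le hyρ (min_le_right _ _))
    have h3 : (Φ ((y : ℂ) * Complex.I)).im = y * (Φ ((y : ℂ) * Complex.I) / ((y : ℂ) * Complex.I)).re := by
      have hne : ((y : ℂ) * Complex.I) ≠ 0 := mul_ne_zero (by exact_mod_cast hy.ne') Complex.I_ne_zero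
      conv_lhs => rw [← div_mul_cancel₀ (Φ ((y : ℂ) * Complex.I)) hne]
      simp [Complex.mul_im]
      ring
    have h4 : ((y : ℂ) * Complex.I).im = y := by simp
    rw [h4, h3] at h1
    have h5 : K⁻¹ * (κ₀ * y) ≤ y - y * (Φ ((y : ℂ) * Complex.I) / ((y : ℂ) * Complex.I)).re :=
      (mul_le_mul_of_nonneg_left h2 (inv_nonneg.2 hKpos.le)).trans h1
    have h6 : K⁻¹ * κ₀ * y ≤ (1 - (Φ ((y : ℂ) * Complex.I) / ((y : ℂ) * Complex.I)).re) * y := by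
      linarith [h5]
    exact le_of_mul_le_mul_right h6 hy
  -- pass to the limit `y → 0⁺`
  have hpath : Tendsto (fun y : ℝ ↦ (y : ℂ) * Complex.I) (𝓝[>] 0) (𝓝[upperHalfPlaneSet \ Q] 0) := by
    rw [tendsto_nhdsWithin_iff]
    constructor
    · have : Tendsto (fun y : ℝ ↦ (y : ℂ) * Complex.I) (𝓝 0) (𝓝 ((0 : ℝ) * Complex.I)) :=
        (Complex.continuous_ofReal.mul continuous_const).tendsto 0
      rw [Complex.ofReal_zero, zero_mul] at this
      exact this.mono_left nhdsWithin_le_nhds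
    · filter_upwards [Ioo_mem_nhdsGT hρ] with y hy
      exact hmemU y hy.1 hy.2
  have hlim : Tendsto (fun y : ℝ ↦ 1 - (Φ ((y : ℂ) * Complex.I) / ((y : ℂ) * Complex.I)).re)
      (𝓝[>] 0) (𝓝 (1 - d)) := by
    have h1 : Tendsto (fun y : ℝ ↦ Φ ((y : ℂ) * Complex.I) / ((y : ℂ) * Complex.I)) (𝓝[>] 0)
        (𝓝 (d : ℂ)) := hdΦ.comp hpath
    have h2 := (Complex.continuous_re.tendsto _).comp h1
    simp only [Function.comp_def, Complex.ofReal_re] at h2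
    exact tendsto_const_nhds.sub h2
  have hev : ∀ᶠ y : ℝ in 𝓝[>] 0, K⁻¹ * κ₀ ≤ 1 - (Φ ((y : ℂ) * Complex.I) / ((y : ℂ) * Complex.I)).re := by
    filter_upwards [Ioo_mem_nhdsGT (lt_min hρ (half_pos hr₁))] with y hy
    exact hcomp y hy.1 hy.2
  have := ge_of_tendsto hlim hev
  linarith

end Literature.Probability.RandomPlanarGeometry
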